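import Literature.MathematicalPhysics.QuantumFieldTheory.Balaban1983to89.Beta.PerturbedFamily
import Literature.MathematicalPhysics.QuantumFieldTheory.Balaban1983to89.Beta.DriftRemainder

/-!
# `Balaban1983to89.Beta.ConstRemainderConsumers` — the [III] side AT THE GRADE OF RULING (R10): what the PRIMARY
road's carrier «one-loop drift + CONSTANT-form one-sided remainder `−r ≤ β¹`» buys among the located consumers
(2.6)–(2.9), (2.46) of [III], where it stops (a sharpness witness), and the reading-(α) clamp trick at this grade
(cell `pub-balaban`, unit `b2b-balaban-strat-b14` = β sub-cell CO-LEAD, [III] side; node T11.F; companion of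
`Beta.FlowConsumers`, `Beta.PerturbedFamily`, `Beta.DriftRemainder`)

HONEST FRAMING (cell rule, verbatim, page 1 of everything): discharging `BetaPertH` makes Bałaban's UV stability
UNCONDITIONAL — a real constructive-QFT result; it is NOT the continuum limit and NOT the Clay problem.  (Gloss 1,
BETA-SPEC v1.8d/v1.9b l. 17–18, GAPS G-ref2-14 (a) / G-ref2-20 (a) / G-ref2-23 (a), verbatim: «UNCONDITIONAL» in
[Balaban1989LargeFieldII] (B16) p. 355's interval-hypothesis sense ONLY (`FlowStepRuns.p355Unconditional_of_partialSums`
keeps `hnodes`); the located leaves G-adv3-2 (left inequality of (0.1)/(2.50), d = 4), G-adv3-1 (U2 transfer of B14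
Cor. 3's lower bound) and `SecondExpLeaf` REMAIN.  Gloss 2, BETA-SPEC v1.9e, referee row C-beta-78, BINDING:
«UNCONDITIONAL» = `Beta.Assembly.EventualForm`-unconditional — the END statement with the interval hypothesis removed,
(0.31) in DEFECTED form on all lattices, admissible couplings shrunk to `g ≤ g⋆`; NOT «[Balaban1987RG1] Theorem 2 as
printed»; never the continuum limit / mass gap / Clay.  Gloss 3 is PROPOSED ONLY (BETA-SPEC v1.9n §7.17 (R10-3), NOT
blessed by beta-ref, NOT binding): on the primary road «unconditional» = `FlowStepRuns.BetaPartialSumsLowerH`-unconditional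
END statement; never «Theorem 2 as printed», never continuum / mass gap / Clay.)  THIS MODULE DISCHARGES NOTHING: every
theorem is bookkeeping over real sequences and over the cell's hypothesis carriers (`FlowStep.HBeta`, `Setup.Flow`,
`B12.Construction`, `B12Beta.OneLoopSplit`, `Beta.Drift.OneLoopDrift`, `Beta.RemainderChain.RemainderConst`,
`B14DeltaBeta.CondSmallFC`); nothing about Bałaban's β-functions (1.22), their one-loop parts or 𝐑-terms is asserted.
ABSOLUTE RULE (cell rule, verbatim): "No internally-minted statement may enter as a cited fact. Every hypothesis is
either kernel-proved in this package or a verbatim quotation of a PUBLISHED theorem with page reference. The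
manuscript(s) under audit are NOT citable for their own disputed steps — they are the thing under adjudication;
programme-internal (2001/route/tribunal) claims are never citable."  Accordingly every β-input below is a HYPOTHESIS
BINDER (drift, one-sided constant remainder bound, printed-type upper bound, conditional smallness, continuity); the
`[cite: …]` tags point at the printed display a theorem CONCLUDES or at the printed CONTEXT of a binder, never at a
proof of it.

CITATION HEADER (lean-in-tree rule).  T. Bałaban, *Convergent renormalization expansions for lattice gauge theories*,
Commun. Math. Phys. **119**, 243–285 (1988) [Balaban1988Convergent] = [III] (cell paper B14; journal page = PDF page +
242; renders `HOME/b2b-balaban-ref1/pages/1988-cmp119-convergent-renormalization-p013-x2.png`, `…-p021-x2.png` READ as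
images by this lineage), p. 255 [13], after (2.6): *"where n > m, and β₀ > 0 can be chosen arbitrarily small, if g is
sufficiently small. The inequalities follow from the renormalization group equations (0.20) [I], and from the
properties of the β-functions."*; p. 263 [21], (2.46) with *"for κ₀ ≥ 7 and g sufficiently small"* — the displays are
typed in `B14.lean` / `B14FlowStep.lean` (`B14.FlowIneq26`–`28`, `B14FlowStep.FlowIneq29`, `B14FlowStep.SumIneq246`),
whose headers carry them verbatim.  T. Bałaban, *Renormalization group approach to lattice gauge field theories. I*,
Commun. Math. Phys. **109**, 249–301 (1987) [Balaban1987RG1] = [I] (B12; journal page = PDF page + 248; render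
`…/1987-cmp109-rg-I-small-field-p011-x2.png` read by this lineage), Theorem 2 p. 259 [11], first sentence, verbatim:
*"Let d = 4, G = SU(2), and let γ be a sufficiently small positive constant, then for a sufficiently small positive g
there exists a bare coupling constant g₀ = g₀(ε, g) such that the sequence of the effective coupling constants g_k is
contained in the interval ]0, γ], and g_K = g."* (typed by the carver as `DagBinding.EndpointExistence`; *"A proof of
this theorem, based on perturbative calculations, will be given in a separate paper"* — UNPRINTED, under adjudication,
never a `theorem` here); the split `β_{k+1} = β⁰_{k+1} + β¹_{k+1}(g_0,…,g_k)` with `β¹_{k+1}(…,0) = 0` is (2.12)–(2.14)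
p. 268 (`B12Beta.OneLoopSplit`); «uniformly bounded on this interval» p. 264 (`FlowStep.BetaUpperH`).  T. Bałaban,
*Large field renormalization. II*, Commun. Math. Phys. **122**, 355–392 (1989) [Balaban1989LargeFieldII] (B16; p. 355
reading through `FlowStepRuns` §8).  WHAT IS REPRODUCED: nothing of either paper is re-proved or newly quoted; the module
records, at statement level, what the sub-cell's PRIMARY-road carrier costs and buys on the [III] side.

WHY THIS MODULE (RULING (R10), BETA-SPEC v1.9n §7.17, lead strat-b12 gen 6, 2026-08-19T00:13:43Z).  (R10-1) makes the
COMPOSED road primary and fixes the carrier reaching the END statements as: `B12Beta.OneLoopSplit β`, the drift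
`Beta.Drift.OneLoopDrift b A β⁰` of the one-loop parts (`b = stepBal N L`, `A = constA(…) + Cθ/(1−θ)`, conclusion of
`ComposedRoad.oneLoopDrift_of_composedLegInterface`), and the remainder in the CONSTANT one-sided form `−r ≤ β¹_{k+1}`
with `r ≤ stepBal N L` (row an4's printed-type slot, `Beta.DriftRemainder` / `RemainderChain.RemainderConst`, `r = ε₁·K_rem`);
END grade `FlowStepRuns.BetaPartialSumsLowerH (2A) γ₀ β` ⟹ `p355Unconditional_of_partialSums` / `EndpointExistence`.  The
tree's [III]-side consumers of the drift/(MB) form (`FlowConsumers` §2/§6) consume the remainder in the Lipschitz (AF-1)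
slot `|β¹_{k+1}| ≤ C_r g_k`, which (R10) RETIRED in favour of the strictly weaker constant form (`DriftRemainder.Witness.not_af1`).
So at the (R10) grade the [III] list had no consumer theorem.  THIS MODULE:
§1  `avgAF_of_pointwise_drift` (engine) ⟹ `avgAF_along_of_driftConst`: drift + `−r ≤ β¹` give, along every in-interval
    run, AVERAGED asymptotic freedom with slope `b − r` and defect `2A`; hence for `r < b` STRICTLY the whole list
    `flowControl_along_of_driftConst`(′) ((2.6)–(2.9) printed constants ∧ (2.46), `κ₀ ≥ 6`; γ-smallness `2Aγ² ≤ β₀(2+β₀)`,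
    `2Aγ² ≤ 1/2`, `(√2)^{κ₀−6}(2γ⁴/(b−r) + γ⁶) < 1`), `sum246_along_of_driftConst`, the two-sided-constant-form and
    world-level bundles `flowControl_along_of_driftRemainderConst`, `driftConst_p355_and_sum246`.
§2  WHAT THE END GRADE ALONE BUYS: `flowIneq_along_of_partialSums` — `BetaPartialSumsLowerH M γ₀ β` + the printed upper
    bound + `Mγ² ≤ β₀(2+β₀)` give (2.6)–(2.9) along runs (consumers C1–C7 of MISSING-B14 §8) — and WHERE IT STOPS:
    `Margin.sum246_fails` — a split family with `β⁰ ≡ b`, `β¹_{k+1}(p) = −b·p_k/γ` satisfies the drift (`A = 0`), the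
    two-sided constant form `RemainderConst S γ b` (the margin `r = b` ALLOWED by `DriftRemainder`'s `r ≤ b` and by (R10-1)
    as worded), continuity, the printed-type upper bound, even the SIGN `β ≥ 0`, hence `BetaPartialSumsLowerH 0 γ β` — yet
    the constant sequence `g_k ≡ γ` IS a run of (0.20) currying this family and violates (2.46) at every horizon
    `K ≥ γ^{−κ₀} + 1` (`Margin.not_sum246_const`).  So the (R10-1)/Gloss-3 END grade buys p. 355 + endpoint existence +
    (2.6)–(2.9) but NOT (2.46) (consumer C8: [III] Thm 2 (2.44) second clause, Cor. 3, B16 §1): (2.46) costs the STRICT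
    restriction `r < b`, i.e. `ε₁·K_rem < stepBal N L` — a restriction of the same printed TYPE (ε₁ sufficiently small
    after L, [II] p. 21 after (2.41); the cell's wording, not a quotation) with a sharper constant, NOT a new wall.
§3  THE CLAMP TRICK AT THIS GRADE (reading (α), census item C14; the `EventualForm`-grade version is `Beta.PerturbedFamily`):
    for the REALISED family `β = βᴵ + δ` with HISTORY-LEVEL averaged asymptotic freedom of `βᴵ` (slope `s > 0`, defect `D`,
    finite horizons — the shape every road's output maps into), the printed-type upper bound, joint continuity of `βᴵ, δ`,
    and the B14 §3 lineage's conditional display `CondSmallFC` lifted to histories (threshold `s/2`): the clamp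
    `β̂ = βᴵ + max(−s/2, min(s/2, δ))` (`exists_clamped_avgAF`) has box-wide partial sums `≥ −D`, the shooting applies, along
    its trajectory the flow facts hold at EVERY horizon (slope `s/2`, `B14FlowStep.flowControl_of_avgAF`), the conditional
    smallness fires, the clamp is inactive, forward uniqueness identifies the trajectory with the construction's run:
    `endpointRun_of_condSmallH_avgAF` (with the defected two-sided running `1/g² + (s/2)(K−k) − D ≤ 1/g_k² ≤ 1/g² + (β′+s/2)(K−k)`),
    `endpointExistence_of_condSmallH_avgAF` (`g⋆ = (1/γ² + D)^{−1/2}`), `flowControl_along_of_condSmall_avgAF`,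
    `endpoint_and_flowControl_of_condSmallH_avgAF`.
§4  Instantiation at the (R10) grade: `histAvgAF_of_driftConst` (drift + `−r ≤ β¹`, `r < b`: `s = b − r`, `D = 2A`),
    `endpoint_and_flowControl_of_condSmallH_driftConst`; and the `δ ≡ 0` check `endpoint_and_flowControl_driftConst_unperturbed`.
CONSEQUENCE FOR THE CENSUS (MISSING-B14 §8): under (R10) the [III] side is served at END-statement grade by drift + constant
one-sided remainder with `r < b` strictly; C14 transfers (this §3–§4); the sub-cell's wall is untouched; the only [III]-side
price of (R10) relative to the (AF-1) slot is the strictness `r < b` in place of `DriftRemainder`'s `r ≤ b` for C8.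
NOT CLAIMED: that Bałaban's one-loop parts drift, that his β¹ obeys any bound, that `δ` is conditionally small or
continuous — all binders; nothing of (AF-0)/(M2⁺).

Imports `Beta.PerturbedFamily` (→ `B14DeltaBeta`, `B14FlowStepPerturbed`, `B14FlowStep`, `Beta.Assembly`, `FlowStepRuns`,
`DagBinding`) and `Beta.DriftRemainder` (→ `Beta.Drift`, `RemainderChain`); restates nothing of them (the partial-sum bound
from drift + one-sided constant remainder is USED BY NAME, `DriftRemainder.betaPartialSumsLowerH_of_drift_oneSided`).
Mathlib only otherwise; 0 `sorry`, no `axiom`; the two `def`s are the §2 witness family and its split.  Cell prose: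
`HOME/MISSING-B14.md` v10 §8 C8/C14, `HOME/BETA-SPEC.md` §5.14, GAPS C-sb14-19.
(v1.1, same unit and generation, APPEND-ONLY — every v1 declaration byte-unchanged, no new import) §5 `flowControl_along_of_driftChain`,
`flowControl_along_of_driftChain_half`, `driftChain_p355_and_sum246`: the remainder slot filled by row an4's PRINTED CHAIN
(`RemainderChain.Chain`, `|β¹_{k+1}| ≤ ε₁·K_rem` via `Chain.abs_beta1_le`) with the STRICT restriction `ε₁·K_rem < b` (resp. `2ε₁·K_rem ≤ b`,
slope `b/2`) — the literal (R10-1) chain with the (2.46) conjunct; one-line instances of §1 (as `DriftRemainder` §3 is of its §1).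
-/

namespace Literature.MathematicalPhysics.QuantumFieldTheory.Balaban1983to89.Beta.ConstRemainderConsumers

open Literature.MathematicalPhysics.QuantumFieldTheory.Balaban1983to89
open Literature.MathematicalPhysics.QuantumFieldTheory.Balaban1983to89.FlowStep
open Literature.MathematicalPhysics.QuantumFieldTheory.Balaban1983to89.DagBinding
open Literature.MathematicalPhysics.QuantumFieldTheory.Balaban1983to89.FlowStepRuns
open Literature.MathematicalPhysics.QuantumFieldTheory.Balaban1983to89.B14DeltaBeta
open Literature.MathematicalPhysics.QuantumFieldTheory.Balaban1983to89.Beta.PerturbedFamily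
open Literature.MathematicalPhysics.QuantumFieldTheory.Balaban1983to89.Beta.Drift (OneLoopDrift sum_Ico_ge_of_drift)
open Literature.MathematicalPhysics.QuantumFieldTheory.Balaban1983to89.Beta.RemainderChain (RemainderConst)
open Literature.MathematicalPhysics.QuantumFieldTheory.Balaban1983to89.Beta.DriftRemainder
  (betaPartialSumsLowerH_of_drift_oneSided)

noncomputable section

/-! ## 1. Drift + CONSTANT one-sided remainder ⟹ averaged asymptotic freedom along runs ⟹ the [III] list for `r < b` -/

/-- ENGINE.  If a real sequence `x` dominates a drifting sequence up to a constant — `β0_j − c ≤ x_j` for `j < K`,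
`|Σ_{j<k} β0_j − b k| ≤ A` for all `k` — then every window sum over `[m,n) ⊆ [0,K)` obeys
`(b − c)(n − m) − 2A ≤ Σ_{j∈[m,n)} x_j`: averaged asymptotic freedom with slope `b − c` and defect `2A`. [folklore] -/
theorem avgAF_of_pointwise_drift {β0 x : ℕ → ℝ} {b A c : ℝ} {K : ℕ} (hdrift : OneLoopDrift b A β0)
    (hx : ∀ j, j < K → β0 j - c ≤ x j) :
    ∀ m n, m ≤ n → n ≤ K → (b - c) * ((n : ℝ) - m) - 2 * A ≤ ∑ j ∈ Finset.Ico m n, x j := by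
  intro m n hmn hnK
  have hpt : ∀ j ∈ Finset.Ico m n, β0 j - c ≤ x j := fun j hj =>
    hx j (lt_of_lt_of_le (Finset.mem_Ico.mp hj).2 hnK)
  have hsum := Finset.sum_le_sum hpt
  have hs : ∑ j ∈ Finset.Ico m n, (β0 j - c) = ∑ j ∈ Finset.Ico m n, β0 j - c * ((n : ℝ) - m) := by
    rw [Finset.sum_sub_distrib, Finset.sum_const, Nat.card_Ico, nsmul_eq_mul, Nat.cast_sub hmn]; ring
  rw [hs] at hsum
  have hdr := sum_Ico_ge_of_drift hdrift hmn
  have e : (b - c) * ((n : ℝ) - m) = b * ((n : ℝ) - m) - c * ((n : ℝ) - m) := by ring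
  rw [e]
  linarith

/-- Window sums from a pointwise lower bound against ANOTHER sequence with averaged asymptotic freedom:
`y_j − c ≤ x_j` (`j < N`) and `s(n−m) − D ≤ Σ_{[m,n)} y_j` (`m ≤ n ≤ K`, `N ≤ K`) give `(s − c)(n−m) − D ≤ Σ_{[m,n)} x_j` for
`m ≤ n ≤ N`. [folklore] -/
theorem avgAF_of_pointwise_lower {x y : ℕ → ℝ} {s D c : ℝ} {N K : ℕ} (hNK : N ≤ K)
    (hy : ∀ m n, m ≤ n → n ≤ K → s * ((n : ℝ) - m) - D ≤ ∑ j ∈ Finset.Ico m n, y j)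
    (hx : ∀ j, j < N → y j - c ≤ x j) :
    ∀ m n, m ≤ n → n ≤ N → (s - c) * ((n : ℝ) - m) - D ≤ ∑ j ∈ Finset.Ico m n, x j := by
  intro m n hmn hnN
  have hpt : ∀ j ∈ Finset.Ico m n, y j - c ≤ x j := fun j hj =>
    hx j (lt_of_lt_of_le (Finset.mem_Ico.mp hj).2 hnN)
  have hsum := Finset.sum_le_sum hpt
  have hs : ∑ j ∈ Finset.Ico m n, (y j - c) = ∑ j ∈ Finset.Ico m n, y j - c * ((n : ℝ) - m) := by
    rw [Finset.sum_sub_distrib, Finset.sum_const, Nat.card_Ico, nsmul_eq_mul, Nat.cast_sub hmn]; ring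
  rw [hs] at hsum
  have hY := hy m n hmn (hnN.trans hNK)
  have e : (s - c) * ((n : ℝ) - m) = s * ((n : ℝ) - m) - c * ((n : ℝ) - m) := by ring
  rw [e]
  linarith

/-- **HISTORY-LEVEL averaged asymptotic freedom from drift + one-sided constant remainder.**  For a split `β = β⁰ + β¹`
(`B12Beta.OneLoopSplit`, [Balaban1987RG1] (2.12)–(2.14)) with `OneLoopDrift b A β⁰` and `−r ≤ β¹_{k+1}` on the
`]0,γ₀]`-histories: along EVERY sequence `g` with `g_i ∈ ]0,γ₀]` for `i ≤ K`, `(b − r)(n − m) − 2A ≤ Σ_{j∈[m,n)} β_j(g_0,…,g_j)`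
for all `m ≤ n ≤ K` (the finite-horizon shape consumed by §3).  Drift and remainder bound are HYPOTHESIS BINDERS — the
located unprinted inputs of the sub-cell's primary road (BETA-SPEC §7.17 (R10-1)). [cite: Balaban1987RG1, (2.12)–(2.14) p.268] -/
theorem histAvgAF_of_driftConst {β : HBeta} (S : B12Beta.OneLoopSplit β) {γ₀ b A r : ℝ}
    (hdrift : OneLoopDrift b A S.β0)
    (hlow : ∀ k (q : Fin (k + 1) → ℝ), q ∈ B12Beta.HistBox γ₀ k → -r ≤ S.β1 k q) :
    ∀ (g : ℕ → ℝ) (K : ℕ), (∀ i, i ≤ K → 0 < g i ∧ g i ≤ γ₀) →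
      ∀ m n, m ≤ n → n ≤ K → (b - r) * ((n : ℝ) - m) - 2 * A ≤ ∑ j ∈ Finset.Ico m n, β j (prefixOf g j) := by
  intro g K hg
  refine avgAF_of_pointwise_drift hdrift fun j hj => ?_
  have hq : prefixOf g j ∈ B12Beta.HistBox γ₀ j := fun i => by
    have hi : (i : ℕ) ≤ K := by have := i.isLt; omega
    simpa using hg i hi
  have h1 := hlow j _ hq
  rw [S.split j]
  linarith

/-- Along an in-interval run of a construction currying `β` (`γ ≤ γ₀`): the realised value `β_{j+1}(g_j)` is
`≥ β⁰_j − r` for `j < K`, from the split and the one-sided constant remainder bound on `]0,γ₀]`-histories. [folklore] -/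
theorem realised_ge_of_driftConst {C : B12.Construction} {β : HBeta} (hcur : CurriesHBeta C β)
    (S : B12Beta.OneLoopSplit β) {γ γ₀ r : ℝ} (hγ₀ : γ ≤ γ₀)
    (hlow : ∀ k (q : Fin (k + 1) → ℝ), q ∈ B12Beta.HistBox γ₀ k → -r ≤ S.β1 k q)
    (P : B12.RunParams) (hI : (C P).flow.InInterval γ P.K) :
    ∀ j, j < P.K → S.β0 j - r ≤ (C P).flow.β (j + 1) ((C P).flow.g j) := by
  intro j hj
  obtain ⟨hpt, hbox⟩ := realised_eq_hist hcur P hγ₀ hI hj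
  have h1 := hlow j _ (histBox_of_mem_box hbox)
  rw [hpt, S.split j]
  linarith

/-- **(AvAF) ALONG RUNS FROM DRIFT + ONE-SIDED CONSTANT REMAINDER — the history→run bridge at the (R10) grade.**  For a
construction currying `β = β⁰ + β¹` with `OneLoopDrift b A β⁰` and `−r ≤ β¹_{k+1}` on `]0,γ₀]`-histories: along every run
staying in `]0,γ]` (`γ ≤ γ₀`) up to `K`, `(b − r)(n − m) − 2A ≤ Σ_{j∈[m,n)} β_{j+1}(g_j)` for all `m ≤ n ≤ K` — averaged
asymptotic freedom with slope `b − r` and defect `2A` in the sense of `B14FlowStep.flowControl_of_avgAF`.  NO Lipschitz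
modulus, NO box smallness `C_rγ ≤ …`; the only smallness the [III] list will need is `r < b`. [folklore] -/
theorem avgAF_along_of_driftConst {C : B12.Construction} {β : HBeta} (hcur : CurriesHBeta C β)
    (S : B12Beta.OneLoopSplit β) {γ γ₀ b A r : ℝ} (hγ₀ : γ ≤ γ₀) (hdrift : OneLoopDrift b A S.β0)
    (hlow : ∀ k (q : Fin (k + 1) → ℝ), q ∈ B12Beta.HistBox γ₀ k → -r ≤ S.β1 k q)
    (P : B12.RunParams) (hI : (C P).flow.InInterval γ P.K) :
    ∀ m n, m ≤ n → n ≤ P.K →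
      (b - r) * ((n : ℝ) - m) - 2 * A ≤ ∑ j ∈ Finset.Ico m n, (C P).flow.β (j + 1) ((C P).flow.g j) :=
  avgAF_of_pointwise_drift hdrift (realised_ge_of_driftConst hcur S hγ₀ hlow P hI)

/-- **(2.6)–(2.9) AND (2.46) ALONG AN IN-INTERVAL RUN AT THE (R10) GRADE, `r < b`.**  For a forward-generated construction
that halts outside and curries `β`, split `β = β⁰ + β¹` with `OneLoopDrift b A β⁰` (BINDER), `−r ≤ β¹_{k+1}` on the
`]0,γ₀]`-histories (BINDER, row an4's printed-type slot, one-sided) with `r < b` STRICTLY, the PRINTED upper bound `β ≤ β′`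
on the boxes ([Balaban1987RG1] p. 264), `SmallnessFor γ β′ β₀ L p` (`γ ≤ γ₀`), sizes `R_j` as in (2.5), and γ-smallness of the
defect `2A`: `2Aγ² ≤ β₀(2+β₀)`, `2Aγ² ≤ 1/2`, `(√2)^{κ₀−6}(2γ⁴/(b−r) + γ⁶) < 1` — ALL of (2.6), (2.7), (2.8), (2.9) with the
printed constants and (2.46) for every `κ₀ ≥ 6` at the horizon `K` (`B14FlowStep.flowControl_of_avgAF`, slope `b − r`).
No limit, no rate, no sign of any `β⁰_{k+1}`, no (AF-1). [cite: Balaban1988Convergent, (2.6)–(2.9) pp.255–256 and (2.46) p.263] -/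
theorem flowControl_along_of_driftConst {C : B12.Construction} {β : HBeta} (hgen : ForwardGenerated C β)
    (hhalt : HaltsOutside C β) (hcur : CurriesHBeta C β) (S : B12Beta.OneLoopSplit β)
    {γ γ₀ b A r β' β₀ : ℝ} {L p : ℕ} (Sm : B14FlowStep.SmallnessFor γ β' β₀ L p) {A₀ : ℝ} (hA₀ : 0 ≤ A₀)
    (hγ₀ : γ ≤ γ₀) (hdrift : OneLoopDrift b A S.β0)
    (hlow : ∀ k (q : Fin (k + 1) → ℝ), q ∈ B12Beta.HistBox γ₀ k → -r ≤ S.β1 k q) (hrb : r < b)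
    (hup : BetaUpperH β' γ₀ β)
    (hAγ : 2 * A * γ ^ 2 ≤ β₀ * (2 + β₀)) (hAγ' : 2 * A * γ ^ 2 ≤ 1 / 2) {κ₀ : ℕ} (hκ : 6 ≤ κ₀)
    (hsmall : Real.sqrt 2 ^ (κ₀ - 6) * (2 * γ ^ 4 / (b - r) + γ ^ 6) < 1)
    (P : B12.RunParams) (hI : (C P).flow.InInterval γ P.K)
    (Rj : ℕ → ℕ) (hRj : ∀ j, j ≤ P.K → B14.IsRj L p ((C P).flow.g j) (Rj j)) :
    HorizonFacts (C P).flow β' β₀ A₀ L p κ₀ Rj P.K := by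
  have hrg : (C P).flow.SatisfiesRG P.K := satisfiesRG_of_inInterval hgen hhalt hcur P hI
  have hub : ∀ j, j < P.K → (C P).flow.β (j + 1) ((C P).flow.g j) ≤ β' := by
    intro j hj
    obtain ⟨hpt, hbox⟩ := realised_eq_hist hcur P hγ₀ hI hj
    rw [hpt]; exact hup j _ hbox
  exact B14FlowStep.flowControl_of_avgAF (C P).flow P.K Sm hA₀ Rj hRj hrg hI hub (sub_pos.mpr hrb)
    (avgAF_along_of_driftConst hcur S hγ₀ hdrift hlow P hI) hAγ hAγ' hκ hsmall

/-- **Sizes supplied**: along every in-interval run there ARE sizes `R_j` obeying (2.5) (`B14FlowStep.isRj_exists`, `L ≥ 2`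
from `SmallnessFor`) for which the whole list holds at the (R10) grade, `r < b`. [cite: Balaban1988Convergent, (2.5)–(2.9) pp.255–256 and (2.46) p.263] -/
theorem flowControl_along_of_driftConst' {C : B12.Construction} {β : HBeta} (hgen : ForwardGenerated C β)
    (hhalt : HaltsOutside C β) (hcur : CurriesHBeta C β) (S : B12Beta.OneLoopSplit β)
    {γ γ₀ b A r β' β₀ : ℝ} {L p : ℕ} (Sm : B14FlowStep.SmallnessFor γ β' β₀ L p) {A₀ : ℝ} (hA₀ : 0 ≤ A₀)
    (hγ₀ : γ ≤ γ₀) (hdrift : OneLoopDrift b A S.β0)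
    (hlow : ∀ k (q : Fin (k + 1) → ℝ), q ∈ B12Beta.HistBox γ₀ k → -r ≤ S.β1 k q) (hrb : r < b)
    (hup : BetaUpperH β' γ₀ β)
    (hAγ : 2 * A * γ ^ 2 ≤ β₀ * (2 + β₀)) (hAγ' : 2 * A * γ ^ 2 ≤ 1 / 2) {κ₀ : ℕ} (hκ : 6 ≤ κ₀)
    (hsmall : Real.sqrt 2 ^ (κ₀ - 6) * (2 * γ ^ 4 / (b - r) + γ ^ 6) < 1)
    (P : B12.RunParams) (hI : (C P).flow.InInterval γ P.K) :
    ∃ Rj : ℕ → ℕ, (∀ j, B14.IsRj L p ((C P).flow.g j) (Rj j)) ∧ HorizonFacts (C P).flow β' β₀ A₀ L p κ₀ Rj P.K := by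
  choose Rj hRj using fun j => B14FlowStep.isRj_exists Sm.hL p ((C P).flow.g j)
  exact ⟨Rj, hRj, flowControl_along_of_driftConst hgen hhalt hcur S Sm hA₀ hγ₀ hdrift hlow hrb hup hAγ hAγ' hκ hsmall P hI
    Rj fun j _ => hRj j⟩

/-- **(2.46) alone along an in-interval run at the (R10) grade** (no `SmallnessFor`, no sizes, no upper bound): drift,
`−r ≤ β¹`, `r < b`, `2Aγ² ≤ 1/2`, `(√2)^{κ₀−6}(2γ⁴/(b−r) + γ⁶) < 1`, `κ₀ ≥ 6` (`B14FlowStep.sumIneq246_of_avgAF`).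
[cite: Balaban1988Convergent, (2.46) p.263] -/
theorem sum246_along_of_driftConst {C : B12.Construction} {β : HBeta} (hgen : ForwardGenerated C β)
    (hhalt : HaltsOutside C β) (hcur : CurriesHBeta C β) (S : B12Beta.OneLoopSplit β) {γ γ₀ b A r : ℝ}
    (hγ₀ : γ ≤ γ₀) (hdrift : OneLoopDrift b A S.β0)
    (hlow : ∀ k (q : Fin (k + 1) → ℝ), q ∈ B12Beta.HistBox γ₀ k → -r ≤ S.β1 k q) (hrb : r < b)
    (hAγ' : 2 * A * γ ^ 2 ≤ 1 / 2) {κ₀ : ℕ} (hκ : 6 ≤ κ₀)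
    (hsmall : Real.sqrt 2 ^ (κ₀ - 6) * (2 * γ ^ 4 / (b - r) + γ ^ 6) < 1)
    (P : B12.RunParams) (hI : (C P).flow.InInterval γ P.K) :
    B14FlowStep.SumIneq246 (C P).flow.g κ₀ P.K :=
  B14FlowStep.sumIneq246_of_avgAF (C P).flow P.K (sub_pos.mpr hrb) (satisfiesRG_of_inInterval hgen hhalt hcur P hI) hI
    (avgAF_along_of_driftConst hcur S hγ₀ hdrift hlow P hI) hAγ' hκ hsmall

/-- **The same read on row an4's TWO-SIDED constant-form carrier `RemainderChain.RemainderConst S γ₀ r`** (`|β¹_{k+1}| ≤ r`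
on `]0,γ₀]^{k+1}`, all k; `r = ε₁·K_rem` from the printed chain, `RemainderChain.Chain.abs_beta1_le`) with `r < b`: sizes and
the whole list along every in-interval run. [cite: Balaban1988Convergent, (2.5)–(2.9) pp.255–256 and (2.46) p.263] -/
theorem flowControl_along_of_driftRemainderConst {C : B12.Construction} {β : HBeta} (hgen : ForwardGenerated C β)
    (hhalt : HaltsOutside C β) (hcur : CurriesHBeta C β) (S : B12Beta.OneLoopSplit β)
    {γ γ₀ b A r β' β₀ : ℝ} {L p : ℕ} (Sm : B14FlowStep.SmallnessFor γ β' β₀ L p) {A₀ : ℝ} (hA₀ : 0 ≤ A₀)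
    (hγ₀ : γ ≤ γ₀) (hdrift : OneLoopDrift b A S.β0) (hrem : RemainderConst S γ₀ r) (hrb : r < b)
    (hup : BetaUpperH β' γ₀ β)
    (hAγ : 2 * A * γ ^ 2 ≤ β₀ * (2 + β₀)) (hAγ' : 2 * A * γ ^ 2 ≤ 1 / 2) {κ₀ : ℕ} (hκ : 6 ≤ κ₀)
    (hsmall : Real.sqrt 2 ^ (κ₀ - 6) * (2 * γ ^ 4 / (b - r) + γ ^ 6) < 1)
    (P : B12.RunParams) (hI : (C P).flow.InInterval γ P.K) :
    ∃ Rj : ℕ → ℕ, (∀ j, B14.IsRj L p ((C P).flow.g j) (Rj j)) ∧ HorizonFacts (C P).flow β' β₀ A₀ L p κ₀ Rj P.K :=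
  flowControl_along_of_driftConst' hgen hhalt hcur S Sm hA₀ hγ₀ hdrift (fun k q hq => (abs_le.mp (hrem k q hq)).1) hrb
    hup hAγ hAγ' hκ hsmall P hI

/-- **The cell's END statement WITH (2.46) at the (R10) grade** (`DriftRemainder.p355Unconditional_of_drift_remainderConst`'s
content through `FlowStepRuns.p355Unconditional_of_partialSums`, `hnodes` kept — Gloss 1 — plus `sum246_along_of_driftConst`):
for a world whose interval is small — `γ ≤ γ₀`, `β′ ≤ β⁺`, `2Aγ² ≤ β₀(2+β₀)`, `2Aγ² ≤ 1/2`, `(√2)^{κ₀−6}(2γ⁴/(b−r) + γ⁶) < 1` —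
drift + two-sided constant remainder + `r < b` + the printed-type upper bound + continuity give the p. 355 unconditional
reading AND (2.46) along every in-interval run.  At `r = b` the first conjunct survives (`r ≤ b` suffices there) and the
second FAILS in general (§2). [cite: Balaban1989LargeFieldII, p.355; Balaban1988Convergent, (2.46) p.263] -/
theorem driftConst_p355_and_sum246 (w : World) (hγw : 0 < w.γ) {γ₀ : ℝ} (hγ₀ : w.γ ≤ γ₀) (hβup : 0 ≤ w.βup)
    (hnodes : ∀ P, Nodes (leaves w P)) {β : HBeta} (hgen : ForwardGenerated w.C.toB12 β)
    (hhalt : HaltsOutside w.C.toB12 β) (hcur : CurriesHBeta w.C.toB12 β) (hcont : BetaContH γ₀ β)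
    (hup : BetaUpperH w.βup γ₀ β) (S : B12Beta.OneLoopSplit β) {b A r : ℝ} (hdrift : OneLoopDrift b A S.β0)
    (hrem : RemainderConst S γ₀ r) (hrb : r < b) (hAγ : 2 * A * w.γ ^ 2 ≤ w.β₀ * (2 + w.β₀))
    (hAγ' : 2 * A * w.γ ^ 2 ≤ 1 / 2) {κ₀ : ℕ} (hκ : 6 ≤ κ₀)
    (hsmall : Real.sqrt 2 ^ (κ₀ - 6) * (2 * w.γ ^ 4 / (b - r) + w.γ ^ 6) < 1) :
    (B16.Sect2Unconditional w.C ∧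
      ∃ Em Ep : ℝ, ∀ m : ℕ, ∃ gstar : ℝ, 0 < gstar ∧ ∀ g : ℝ, 0 < g → g ≤ gstar →
        ∀ K : ℕ, ∃ g0 : ℝ, (w.C ⟨K, m, g0⟩).flow.g K = g ∧
          ∀ k, k ≤ K → ∀ V : (w.C ⟨K, m, g0⟩).Cfg k, B16.UVIneq (w.C ⟨K, m, g0⟩) k V Em Ep) ∧
    ∀ P : B12.RunParams, (w.C.toB12 P).flow.InInterval w.γ P.K →
      B14FlowStep.SumIneq246 (w.C.toB12 P).flow.g κ₀ P.K := by
  have hlow : ∀ k (q : Fin (k + 1) → ℝ), q ∈ B12Beta.HistBox γ₀ k → -r ≤ S.β1 k q :=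
    fun k q hq => (abs_le.mp (hrem k q hq)).1
  refine ⟨p355Unconditional_of_partialSums w hγw hγ₀ (by linarith [hdrift.nonneg]) hβup hAγ hnodes hgen hhalt hcur hcont
    (betaPartialSumsLowerH_of_drift_oneSided S hdrift hlow hrb.le) hup, fun P hI => ?_⟩
  exact sum246_along_of_driftConst hgen hhalt hcur S hγ₀ hdrift hlow hrb hAγ' hκ hsmall P hI

/-! ## 2. What the END grade `BetaPartialSumsLowerH` alone buys on the [III] side — and where it stops -/

/-- **(2.6)–(2.9) ALONG RUNS FROM THE END GRADE ALONE.**  For a forward-generated construction that halts outside and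
curries `β`: `BetaPartialSumsLowerH M γ₀ β` (window sums `≥ −M` along all `]0,γ₀]`-histories), the PRINTED upper bound
`β ≤ β′` on the boxes, `SmallnessFor γ β′ β₀ L p` (`γ ≤ γ₀`), sizes by (2.5) and `Mγ² ≤ β₀(2+β₀)` give (2.6), (2.7), (2.8),
(2.9) with the printed constants at the horizon `K` of every in-interval run (`B14FlowStep.flowControl_of_partialSum`) —
consumers C1–C7 of the cell's census.  (2.46) is NOT among the conclusions: see `Margin.sum246_fails`. [cite: Balaban1988Convergent, (2.6)–(2.9) pp.255–256] -/
theorem flowIneq_along_of_partialSums {C : B12.Construction} {β : HBeta} (hgen : ForwardGenerated C β)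
    (hhalt : HaltsOutside C β) (hcur : CurriesHBeta C β) {γ γ₀ M β' β₀ : ℝ} {L p : ℕ}
    (Sm : B14FlowStep.SmallnessFor γ β' β₀ L p) {A₀ : ℝ} (hA₀ : 0 ≤ A₀) (hγ₀ : γ ≤ γ₀)
    (hps : BetaPartialSumsLowerH M γ₀ β) (hup : BetaUpperH β' γ₀ β) (hMγ : M * γ ^ 2 ≤ β₀ * (2 + β₀))
    (P : B12.RunParams) (hI : (C P).flow.InInterval γ P.K)
    (Rj : ℕ → ℕ) (hRj : ∀ j, j ≤ P.K → B14.IsRj L p ((C P).flow.g j) (Rj j)) :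
    B14.FlowIneq26 (C P).flow.g β' β₀ P.K ∧ B14.FlowIneq27 (C P).flow.g β' β₀ p P.K ∧
      B14.FlowIneq28 (epsK A₀ p (C P).flow) (C P).flow.g β' β₀ P.K ∧
      B14FlowStep.FlowIneq29 Rj (C P).flow.g L β' β₀ P.K := by
  have hrg : (C P).flow.SatisfiesRG P.K := satisfiesRG_of_inInterval hgen hhalt hcur P hI
  have hub : ∀ j, j < P.K → (C P).flow.β (j + 1) ((C P).flow.g j) ≤ β' := by
    intro j hj
    obtain ⟨hpt, hbox⟩ := realised_eq_hist hcur P hγ₀ hI hj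
    rw [hpt]; exact hup j _ hbox
  -- extend the run's couplings beyond the horizon by a box value, to feed the all-time quantifier of the END grade
  have hγpos : 0 < γ := Sm.γ_pos
  set g' : ℕ → ℝ := fun i => if i ≤ P.K then (C P).flow.g i else γ with hg'
  have hg'box : ∀ i, 0 < g' i ∧ g' i ≤ γ₀ := by
    intro i
    by_cases hi : i ≤ P.K
    · simp only [hg', hi, if_true]; exact ⟨(hI i hi).1, (hI i hi).2.trans hγ₀⟩
    · simp only [hg', hi, if_false]; exact ⟨hγpos, hγ₀⟩
  have hpre : ∀ j, j < P.K → prefixOf g' j = prefixOf (C P).flow.g j := by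
    intro j hj
    funext i
    have hi : (i : ℕ) ≤ P.K := by have := i.isLt; omega
    simp [prefixOf, hg', hi]
  have hpsrun : ∀ m n, m ≤ n → n ≤ P.K →
      -M ≤ ∑ j ∈ Finset.Ico m n, (C P).flow.β (j + 1) ((C P).flow.g j) := by
    intro m n hmn hnK
    have h := hps g' hg'box m n hmn
    have hsum : ∑ j ∈ Finset.Ico m n, β j (prefixOf g' j)
        = ∑ j ∈ Finset.Ico m n, (C P).flow.β (j + 1) ((C P).flow.g j) := by
      refine Finset.sum_congr rfl fun j hj => ?_
      have hjK : j < P.K := lt_of_lt_of_le (Finset.mem_Ico.mp hj).2 hnK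
      rw [hpre j hjK, (realised_eq_hist hcur P hγ₀ hI hjK).1]
    rw [hsum] at h
    exact h
  exact B14FlowStep.flowControl_of_partialSum (C P).flow P.K Sm hA₀ Rj hRj hrg hI hub hpsrun hMγ

namespace Margin

/-- The MARGIN witness family (`r = b`): `β_{k+1}(p) = b − b·p_k/γ` — one-loop part `≡ b`, remainder `−b·p_k/γ`.
Elementary; nothing of the series. [folklore] -/
def betaM (b γ : ℝ) : HBeta := fun k p => b - b * (p (Fin.last k) / γ)

/-- Its split along [Balaban1987RG1] (2.12)–(2.14): `β⁰ ≡ b`, `β¹_{k+1}(p) = −b·p_k/γ`, vanishing at `p_k = 0`. [folklore] -/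
def splitM (b γ : ℝ) : B12Beta.OneLoopSplit (betaM b γ) where
  β0 := fun _ => b
  β1 := fun k p => -(b * (p (Fin.last k) / γ))
  split := fun k p => by simp only [betaM]; ring
  vanish := fun k p hp => by simp [hp]

/-- The one-loop part drifts with slope `b` and `A = 0`. [folklore] -/
theorem drift (b γ : ℝ) : OneLoopDrift b 0 (splitM b γ).β0 := fun k => by
  simp only [splitM, Finset.sum_const, Finset.card_range, nsmul_eq_mul]
  rw [show (k : ℝ) * b - b * k = 0 by ring, abs_zero]

/-- The remainder obeys the TWO-SIDED constant form with `r = b` EXACTLY on every `]0,γ]`-box (`b ≥ 0`, `γ > 0`). [folklore] -/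
theorem remainderConst {b γ : ℝ} (hb : 0 ≤ b) (hγ : 0 < γ) : RemainderConst (splitM b γ) γ b := by
  intro k p hp
  have hpk := hp (Fin.last k)
  have h0 : 0 ≤ p (Fin.last k) / γ := div_nonneg hpk.1.le hγ.le
  have h1 : p (Fin.last k) / γ ≤ 1 := (div_le_one hγ).mpr hpk.2
  show |-(b * (p (Fin.last k) / γ))| ≤ b
  rw [abs_neg, abs_of_nonneg (mul_nonneg hb h0)]
  nlinarith

/-- Each `β_{k+1}` of the witness is continuous everywhere, hence jointly continuous on every box. [folklore] -/
theorem cont (b γ γ' : ℝ) : BetaContH γ' (betaM b γ) := fun k => by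
  have : Continuous (betaM b γ k) := by unfold betaM; fun_prop
  exact this.continuousOn

/-- The printed-type upper bound `β ≤ b` and the SIGN `0 ≤ β` hold on the `]0,γ]`-boxes (`b ≥ 0`, `γ > 0`). [folklore] -/
theorem upper_and_sign {b γ : ℝ} (hb : 0 ≤ b) (hγ : 0 < γ) :
    BetaUpperH b γ (betaM b γ) ∧ BetaLowerH 0 γ (betaM b γ) := by
  refine ⟨fun k v hv => ?_, fun k v hv => ?_⟩
  · have hvk := mem_box.mp hv (Fin.last k)
    have h0 : 0 ≤ b * (v (Fin.last k) / γ) := mul_nonneg hb (div_nonneg hvk.1.le hγ.le)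
    show b - b * (v (Fin.last k) / γ) ≤ b
    linarith
  · have hvk := mem_box.mp hv (Fin.last k)
    have h1 : v (Fin.last k) / γ ≤ 1 := (div_le_one hγ).mpr hvk.2
    show (0 : ℝ) ≤ b - b * (v (Fin.last k) / γ)
    nlinarith

/-- Hence the END grade holds for the witness with the best constant: `BetaPartialSumsLowerH 0 γ (betaM b γ)` — both from the
sign (`FlowStepRuns.betaPartialSumsLowerH_of_sign`) and, as the margin case `r = b` of row an4's theorem, from drift +
constant form (`DriftRemainder.betaPartialSumsLowerH_of_drift_oneSided`, recorded as an `example` below). [folklore] -/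
theorem partialSums {b γ : ℝ} (hb : 0 ≤ b) (hγ : 0 < γ) : BetaPartialSumsLowerH 0 γ (betaM b γ) :=
  betaPartialSumsLowerH_of_sign (upper_and_sign hb hγ).2

/- The margin `r = b` IS admitted by `DriftRemainder`'s hypothesis `r ≤ b` (kernel check, no new declaration). -/
example {b γ : ℝ} (hb : 0 ≤ b) (hγ : 0 < γ) : BetaPartialSumsLowerH (2 * 0) γ (betaM b γ) :=
  betaPartialSumsLowerH_of_drift_oneSided (splitM b γ) (drift b γ)
    (fun k q hq => (abs_le.mp (remainderConst hb hγ k q hq)).1) le_rfl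

/-- The constant run at the top of the interval: couplings `g_k ≡ γ`, run-wise β-functions `x ↦ b − b·x/γ` (which CURRY
the witness family in the sense of `DagBinding.CurriesHBeta`).  It solves (0.20) (`1/γ² = 1/γ² + 0`) and stays in `]0,γ]`
for every horizon. [folklore] -/
theorem constRun (b : ℝ) {γ : ℝ} (hγ : 0 < γ) (K : ℕ) :
    (⟨fun _ => γ, fun _ x => b - b * (x / γ)⟩ : Flow).SatisfiesRG K ∧
      (⟨fun _ => γ, fun _ x => b - b * (x / γ)⟩ : Flow).InInterval γ K ∧
      (∀ j x, (⟨fun _ => γ, fun _ x => b - b * (x / γ)⟩ : Flow).β (j + 1) x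
        = betaM b γ j (Function.update (prefixOf (fun _ => γ) j) (Fin.last j) x)) := by
  refine ⟨fun k _ => ?_, fun k _ => ⟨hγ, le_rfl⟩, fun j x => ?_⟩
  · show 1 / γ ^ 2 = 1 / γ ^ 2 + (b - b * (γ / γ))
    rw [div_self hγ.ne']; ring
  · simp [betaM]

/-- Along a constant sequence `g_k ≡ γ` with `0 < γ ≤ 1`, (2.46) FAILS at every horizon `K ≥ γ^{−κ₀} + 1`:
`Σ_{j=1}^{K} γ^{κ₀} = Kγ^{κ₀} ≥ 1 + γ^{κ₀} > 1 ≥ γ^{κ₀−6}`. [folklore] -/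
theorem not_sum246_const {γ : ℝ} (hγ : 0 < γ) (hγ1 : γ ≤ 1) (κ₀ : ℕ) :
    ¬ B14FlowStep.SumIneq246 (fun _ : ℕ => γ) κ₀ (⌈(γ ^ κ₀)⁻¹⌉₊ + 1) := by
  intro h
  set K : ℕ := ⌈(γ ^ κ₀)⁻¹⌉₊ + 1 with hK
  have hKs := h K le_rfl
  simp only [Finset.sum_const, Nat.card_Icc, Nat.add_sub_cancel, nsmul_eq_mul] at hKs
  have hγκ : 0 < γ ^ κ₀ := pow_pos hγ κ₀
  have hceil : (γ ^ κ₀)⁻¹ ≤ (⌈(γ ^ κ₀)⁻¹⌉₊ : ℝ) := Nat.le_ceil _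
  have hKreal : (K : ℝ) = (⌈(γ ^ κ₀)⁻¹⌉₊ : ℝ) + 1 := by rw [hK]; push_cast; ring
  have hKge : (γ ^ κ₀)⁻¹ + 1 ≤ (K : ℝ) := by rw [hKreal]; linarith
  have hprod : 1 + γ ^ κ₀ ≤ (K : ℝ) * γ ^ κ₀ := by
    have := mul_le_mul_of_nonneg_right hKge hγκ.le
    rwa [add_mul, inv_mul_cancel₀ hγκ.ne', one_mul] at this
  have hpow1 : γ ^ (κ₀ - 6) ≤ 1 := pow_le_one₀ hγ.le hγ1
  linarith

/-- **SHARPNESS OF `r < b` / WHERE THE END GRADE STOPS.**  For every interval bound `0 < γ ≤ 1`, slope `b ≥ 0` and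
exponent `κ₀` there are a history family `β` with a split `S` such that: the one-loop part DRIFTS (`OneLoopDrift b 0`),
the remainder obeys the two-sided CONSTANT form with `r = b` (`RemainderConst S γ b` — the margin admitted by
`DriftRemainder`'s `r ≤ b` and by BETA-SPEC §7.17 (R10-1) «r ≤ stepBal N L» as worded), `β` is jointly continuous, obeys the
printed-type upper bound `β ≤ b` and even the SIGN `0 ≤ β` on the boxes, so that the END grade `BetaPartialSumsLowerH 0 γ β`
holds — and yet a flow that solves (0.20), stays in `]0,γ]` and curries `β` VIOLATES (2.46) at some horizon.  So neither the
(R10-1) carrier at the margin nor the Gloss-3 END grade buys consumer C8 ((2.46): [III] Thm 2 (2.44) second clause, Cor. 3,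
B16 §1); §1's strict `r < b` is needed, with the (2.46) γ-smallness degenerating like `γ⁴/(b − r)`.  Elementary witness;
nothing of the series. [cite: Balaban1988Convergent, (2.46) p.263] -/
theorem sum246_fails {γ b : ℝ} (hγ : 0 < γ) (hγ1 : γ ≤ 1) (hb : 0 ≤ b) (κ₀ : ℕ) :
    ∃ (β : HBeta) (S : B12Beta.OneLoopSplit β),
      OneLoopDrift b 0 S.β0 ∧ RemainderConst S γ b ∧ BetaContH γ β ∧ BetaUpperH b γ β ∧ BetaLowerH 0 γ β ∧
      BetaPartialSumsLowerH 0 γ β ∧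
      ∃ (K : ℕ) (F : Flow), F.SatisfiesRG K ∧ F.InInterval γ K ∧
        (∀ j x, F.β (j + 1) x = β j (Function.update (prefixOf F.g j) (Fin.last j) x)) ∧
        ¬ B14FlowStep.SumIneq246 F.g κ₀ K := by
  obtain ⟨hrg, hI, hcur⟩ := constRun b hγ (⌈(γ ^ κ₀)⁻¹⌉₊ + 1)
  exact ⟨betaM b γ, splitM b γ, drift b γ, remainderConst hb hγ, cont b γ γ, (upper_and_sign hb hγ).1,
    (upper_and_sign hb hγ).2, partialSums hb hγ, ⌈(γ ^ κ₀)⁻¹⌉₊ + 1, ⟨fun _ => γ, fun _ x => b - b * (x / γ)⟩, hrg, hI,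
    hcur, not_sum246_const hγ hγ1 κ₀⟩

end Margin

/-! ## 3. The CLAMP TRICK at this grade (reading (α), census item C14): history-level averaged asymptotic freedom of the
[I]-part + the conditional (Δβ) display + continuity ⟹ endpoint existence AND the [III] list for `βᴵ + δ` -/

/-- **The clamped family at threshold `θ`.**  For `β = βᴵ + δ` on the boxes `]0,γ₀]^{k+1}` with `βᴵ ≤ β′` there and `βᴵ, δ`
jointly continuous, the family `β̂ := βᴵ + max(−θ, min(θ, δ))` (`θ ≥ 0`) is jointly continuous on the boxes, satisfies
`β̂ ≤ β′ + θ` and `βᴵ − θ ≤ β̂` there, and COINCIDES with `β` at every box history where `|δ| ≤ θ`.  (No tail / lower bound on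
`βᴵ` is needed, unlike `PerturbedFamily.exists_clamped`.)  Elementary. [folklore] -/
theorem exists_clamped_avgAF {β βI δ : HBeta} {γ₀ θ β' : ℝ} (hθ : 0 ≤ θ)
    (hsplit : ∀ k, ∀ v ∈ Box γ₀ k, β k v = βI k v + δ k v) (hup : BetaUpperH β' γ₀ βI)
    (hcontI : BetaContH γ₀ βI) (hcontδ : BetaContH γ₀ δ) :
    ∃ βc : HBeta, BetaContH γ₀ βc ∧ BetaUpperH (β' + θ) γ₀ βc ∧
      (∀ k, ∀ v ∈ Box γ₀ k, βI k v - θ ≤ βc k v) ∧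
      (∀ k, ∀ v ∈ Box γ₀ k, |δ k v| ≤ θ → βc k v = β k v) := by
  refine ⟨fun k v => βI k v + max (-θ) (min θ (δ k v)), ?_, ?_, ?_, ?_⟩
  · intro k
    have hcl : Continuous fun t : ℝ => max (-θ) (min θ t) :=
      continuous_const.max (continuous_const.min continuous_id)
    exact (hcontI k).add (hcl.comp_continuousOn (hcontδ k))
  · intro k v hv
    have h1 : max (-θ) (min θ (δ k v)) ≤ θ := max_le (by linarith) (min_le_left _ _)
    have h2 := hup k v hv
    show βI k v + max (-θ) (min θ (δ k v)) ≤ β' + θ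
    linarith
  · intro k v _
    have h1 : -θ ≤ max (-θ) (min θ (δ k v)) := le_max_left _ _
    show βI k v - θ ≤ βI k v + max (-θ) (min θ (δ k v))
    linarith
  · intro k v hv hδ
    have h1 : min θ (δ k v) = δ k v := min_eq_right (abs_le.mp hδ).2
    have h2 : max (-θ) (δ k v) = δ k v := max_eq_right (abs_le.mp hδ).1
    show βI k v + max (-θ) (min θ (δ k v)) = β k v
    rw [h1, h2, hsplit k v hv]

/-- **The endpoint RUN under reading (α) at the averaged grade, with the DEFECTED two-sided running along it.**  Let the
construction `C` be generated forward by (0.20) with the REALISED family `β = βᴵ + δ` on the boxes `]0,γ₀]^{k+1}`; let `βᴵ`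
have HISTORY-LEVEL averaged asymptotic freedom — `s(n−m) − D ≤ Σ_{j∈[m,n)} βᴵ_j(g_0,…,g_j)` for all `m ≤ n ≤ K` along every
sequence with `g_i ∈ ]0,γ₀]` (`i ≤ K`), `s > 0`, `D ≥ 0` (the finite-horizon shape into which every road's output maps: §4) —
and the printed-type upper bound `βᴵ ≤ β′` (`β′ ≥ 0`); let `βᴵ, δ` be jointly continuous on the boxes; and let `δ` be
CONDITIONALLY small HISTORY-WISE with threshold `s/2`: along every flow solving (0.20) in `]0, min(γ₀,γ₁)]` up to `K`, for all
admissible sizes, the printed flow facts up to the horizon `k < K` imply `|δ_k(g_0,…,g_k)| ≤ s/2` (`B14DeltaBeta.CondSmallFC`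
lifted to histories — the lineage's READING, DIVERGENCE D-sb14.6; print asserts no bound).  Then with ONE threshold `γ₁`
(`SmallnessFor γ₁ (β′+s/2) β₀ L p`, `Dγ₁² ≤ β₀(2+β₀)`, `Dγ₁² ≤ 1/2`, `(√2)^{κ−6}(2γ₁⁴/(s/2) + γ₁⁶) < 1`, `κ ≥ 6`): for every `m`,
every `γ ≤ min(γ₀,γ₁)`, every `g > 0` with `1/γ² + D ≤ 1/g²` and EVERY `K`, a bare coupling whose run stays in `]0,γ]`, ends
at `g_K = g`, and satisfies for all `k ≤ K`: `1/g² + (s/2)(K−k) − D ≤ 1/g_k²`, `1/g² − D ≤ 1/g_k²`,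
`1/g_k² ≤ 1/g² + (β′+s/2)(K−k)`.  PROOF = the clamp trick of `Beta.PerturbedFamily` at this grade: shoot with `β̂` of
`exists_clamped_avgAF` (`θ = s/2`; its window sums are `≥ (s/2)(n−m) − D ≥ −D` box-wide, so
`FlowStepRuns.couplingTrajectory_exists_partialSums` applies); along the (0.20)-trajectory of `β̂` so produced the realised
values have slope `s/2`, defect `D`, bound `β′+s/2`, so `B14FlowStep.flowControl_of_avgAF` gives the flow facts at EVERY
horizon; the conditional smallness fires, the clamp is inactive, the trajectory solves (0.20) for `β`, and forward
uniqueness (`FlowStepRuns.flow_eq_of_rgEqH`) identifies it with `C`'s run; the lower running is `B14FlowStep.running_of_avgAF`.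
[cite: Balaban1987RG1, Thm 2 p.259 (first sentence) and (0.20) p.256] [cite: Balaban1988Convergent, (2.6)–(2.9) pp.255–256, (2.46) p.263, p.271, p.278] -/
theorem endpointRun_of_condSmallH_avgAF {C : B12.Construction} {β βI δ : HBeta}
    (hgen : ForwardGenerated C β) {γ₀ : ℝ}
    (hsplit : ∀ k, ∀ v ∈ Box γ₀ k, β k v = βI k v + δ k v)
    {γ₁ s D β' β₀ A₀ : ℝ} {L p κ : ℕ} (Sm : B14FlowStep.SmallnessFor γ₁ (β' + s / 2) β₀ L p) (hA₀ : 0 ≤ A₀)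
    (hs : 0 < s) (hD : 0 ≤ D) (hβ' : 0 ≤ β')
    (havI : ∀ (g : ℕ → ℝ) (K : ℕ), (∀ i, i ≤ K → 0 < g i ∧ g i ≤ γ₀) →
      ∀ m n, m ≤ n → n ≤ K → s * ((n : ℝ) - m) - D ≤ ∑ j ∈ Finset.Ico m n, βI j (prefixOf g j))
    (hup : BetaUpperH β' γ₀ βI) (hcontI : BetaContH γ₀ βI) (hcontδ : BetaContH γ₀ δ)
    (hDγ : D * γ₁ ^ 2 ≤ β₀ * (2 + β₀)) (hDγ' : D * γ₁ ^ 2 ≤ 1 / 2) (hκ : 6 ≤ κ)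
    (hsmall : Real.sqrt 2 ^ (κ - 6) * (2 * γ₁ ^ 4 / (s / 2) + γ₁ ^ 6) < 1)
    (hcs : ∀ (F : Flow) (K : ℕ) (R : ℕ → ℕ), F.SatisfiesRG K → F.InInterval (min γ₀ γ₁) K →
      (∀ j, j ≤ K → B14.IsRj L p (F.g j) (R j)) →
      CondSmallFC F (β' + s / 2) β₀ A₀ L p κ R (fun k => δ k (prefixOf F.g k)) K (s / 2)) :
    ∀ (m : ℕ) (γ : ℝ), 0 < γ → γ ≤ min γ₀ γ₁ → ∀ g : ℝ, 0 < g → 1 / γ ^ 2 + D ≤ 1 / g ^ 2 →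
      ∀ K : ℕ, ∃ g0 : ℝ, (C ⟨K, m, g0⟩).flow.InInterval γ K ∧ (C ⟨K, m, g0⟩).flow.g K = g ∧
        ∀ k, k ≤ K →
          1 / g ^ 2 + s / 2 * ((K : ℝ) - k) - D ≤ 1 / ((C ⟨K, m, g0⟩).flow.g k) ^ 2 ∧
          1 / g ^ 2 - D ≤ 1 / ((C ⟨K, m, g0⟩).flow.g k) ^ 2 ∧
          1 / ((C ⟨K, m, g0⟩).flow.g k) ^ 2 ≤ 1 / g ^ 2 + (β' + s / 2) * ((K : ℝ) - k) := by
  obtain ⟨βc, hcontc, hupc, hloc, hagree⟩ :=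
    exists_clamped_avgAF (half_pos hs).le hsplit hup hcontI hcontδ
  intro m γ hγ hγle g hg hgM K
  have hγγ₀ : γ ≤ γ₀ := hγle.trans (min_le_left _ _)
  have hγγ₁ : γ ≤ γ₁ := hγle.trans (min_le_right _ _)
  -- smallness at γ
  have Smγ : B14FlowStep.SmallnessFor γ (β' + s / 2) β₀ L p := smallnessFor_of_le Sm hγ hγγ₁
  have hDγγ : D * γ ^ 2 ≤ β₀ * (2 + β₀) := defect_of_le hD hγ.le hγγ₁ hDγ
  have hDγγ' : D * γ ^ 2 ≤ 1 / 2 := defect_of_le hD hγ.le hγγ₁ hDγ'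
  have hsmallγ := polySmall_of_le (half_pos hs) hγ.le hγγ₁ hsmall
  have hβ'' : 0 ≤ β' + s / 2 := by positivity
  -- box-wide partial sums of the clamped family: window sums ≥ (s/2)(n−m) − D ≥ −D
  have hps : BetaPartialSumsLowerH D γ₀ βc := by
    intro g' hg' k n hkn
    have hav := avgAF_of_pointwise_lower (x := fun j => βc j (prefixOf g' j)) (y := fun j => βI j (prefixOf g' j))
      (c := s / 2) (N := n) (K := n) le_rfl (havI g' n fun i _ => hg' i) (fun j _ => by
        have hbox : prefixOf g' j ∈ Box γ₀ j := mem_box.mpr fun i => by simpa using hg' i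
        have := hloc j _ hbox
        linarith)
      k n hkn le_rfl
    have hnk : (0 : ℝ) ≤ (n : ℝ) - k := by
      have : (k : ℝ) ≤ n := by exact_mod_cast hkn
      linarith
    have e : (s - s / 2) * ((n : ℝ) - k) = s / 2 * ((n : ℝ) - k) := by ring
    rw [e] at hav
    nlinarith [hav, hnk, hs]
  -- shooting with the clamped family in ]0,γ]
  obtain ⟨gs, hgsK, hrgc, hIgs, hrun⟩ := couplingTrajectory_exists_partialSums βc hγ hD hβ''
    (fun k => (hcontc k).mono (box_mono hγγ₀ k)) (betaPartialSumsLowerH_mono hγγ₀ hps)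
    (fun k v hv => hupc k v (box_mono hγγ₀ k hv)) K g hg hgM
  -- the flow carrying the trajectory, with the clamped family curried along it
  obtain ⟨F, hFg, hFβ⟩ := exists_curriedFlow βc gs
  subst hFg
  have hreal : ∀ j, F.β (j + 1) (F.g j) = βc j (prefixOf F.g j) := by
    intro j; rw [hFβ, update_prefixOf_last]
  have hrgF : F.SatisfiesRG K := by
    intro k hk; rw [hreal]; exact hrgc k hk
  have hIF : F.InInterval γ K := hIgs
  have hboxK : ∀ i, i ≤ K → 0 < F.g i ∧ F.g i ≤ γ₀ := fun i hi => ⟨(hIgs i hi).1, (hIgs i hi).2.trans hγγ₀⟩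
  have hbox : ∀ j, j ≤ K → prefixOf F.g j ∈ Box γ₀ j := by
    intro j hj
    exact mem_box.mpr fun i => by
      have hi : (i : ℕ) ≤ K := by have := i.isLt; omega
      exact hboxK i hi
  -- realised bounds of the clamped family along the trajectory: upper bound and averaged AF with slope s/2, defect D
  have hubF : ∀ j, j < K → F.β (j + 1) (F.g j) ≤ β' + s / 2 := fun j hj => by
    rw [hreal]; exact hupc j _ (hbox j hj.le)
  have havF : ∀ m' n, m' ≤ n → n ≤ K →
      s / 2 * ((n : ℝ) - m') - D ≤ ∑ j ∈ Finset.Ico m' n, F.β (j + 1) (F.g j) := by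
    have h := avgAF_of_pointwise_lower (x := fun j => F.β (j + 1) (F.g j)) (y := fun j => βI j (prefixOf F.g j))
      (c := s / 2) (N := K) (K := K) le_rfl (havI F.g K hboxK) (fun j hj => by
        have := hloc j _ (hbox j hj.le)
        rw [hreal]; linarith)
    have e : s - s / 2 = s / 2 := by ring
    rw [e] at h
    exact h
  -- sizes, and the flow facts at EVERY horizon from the clamped bounds alone
  choose R hR using fun j => B14FlowStep.isRj_exists Sm.hL p (F.g j)
  have hfacts : ∀ k, k ≤ K → HorizonFacts F (β' + s / 2) β₀ A₀ L p κ R k := by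
    intro k hk
    exact B14FlowStep.flowControl_of_avgAF F k Smγ hA₀ R (fun j _ => hR j)
      (fun j hj => hrgF j (lt_of_lt_of_le hj hk)) (fun j hj => hIF j (hj.trans hk))
      (fun j hj => hubF j (lt_of_lt_of_le hj hk)) (half_pos hs)
      (fun m' n hmn hnk => havF m' n hmn (hnk.trans hk)) hDγγ hDγγ' hκ hsmallγ
  -- the conditional smallness fires: the clamp is inactive along the trajectory
  have hIF' : F.InInterval (min γ₀ γ₁) K := fun k hk => ⟨(hIgs k hk).1, (hIgs k hk).2.trans hγle⟩
  have hδ : ∀ k, k < K → |δ k (prefixOf F.g k)| ≤ s / 2 := fun k hk =>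
    hcs F K R hrgF hIF' (fun j _ => hR j) k hk (hfacts k hk.le)
  have hrgβ : RGEqH K β F.g := by
    intro k hk
    rw [← hagree k _ (hbox k hk.le) (hδ k hk)]
    exact hrgc k hk
  -- forward uniqueness: C's run from the same bare coupling IS this trajectory
  have heq : ∀ k, k ≤ K → (C ⟨K, m, F.g 0⟩).flow.g k = F.g k :=
    flow_eq_of_rgEqH (C ⟨K, m, F.g 0⟩).flow β K (fun k hk => hgen.2 ⟨K, m, F.g 0⟩ k hk)
      (hgen.1 ⟨K, m, F.g 0⟩) hrgβ (fun k hk => (hIgs k hk).1)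
  refine ⟨F.g 0, fun k hk => ?_, ?_, fun k hk => ?_⟩
  · rw [heq k hk]; exact hIgs k hk
  · rw [heq K le_rfl]; exact hgsK
  · obtain ⟨h2, h3⟩ := hrun k hk
    have h1 := B14FlowStep.running_of_avgAF F K hrgF havF hk le_rfl
    rw [hgsK] at h1
    rw [heq k hk]
    exact ⟨h1, h2, h3⟩

/-- **Endpoint existence under reading (α) at the averaged grade.**  Under the hypotheses of `endpointRun_of_condSmallH_avgAF`
and `γ₀ > 0`: `DagBinding.EndpointExistence C` — for every `m`, every `γ ≤ min(γ₀,γ₁)`, every `g ≤ g⋆ = (1/γ² + D)^{−1/2}` and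
EVERY `K`, a bare coupling whose run stays in `]0,γ]` and ends at `g_K = g`.  No sign, no rate, no small-k list; the
β-function input is history-level AVERAGED asymptotic freedom of [I]'s part (any road's END-grade output with a slope),
the `δ`-input is the B14 §3 lineage's conditional display + continuity. [cite: Balaban1987RG1, Thm 2 p.259 (first sentence) and (0.20) p.256] [cite: Balaban1988Convergent, p.259, p.271, p.278] -/
theorem endpointExistence_of_condSmallH_avgAF {C : B12.Construction} {β βI δ : HBeta}
    (hgen : ForwardGenerated C β) {γ₀ : ℝ} (hγ₀ : 0 < γ₀)
    (hsplit : ∀ k, ∀ v ∈ Box γ₀ k, β k v = βI k v + δ k v)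
    {γ₁ s D β' β₀ A₀ : ℝ} {L p κ : ℕ} (Sm : B14FlowStep.SmallnessFor γ₁ (β' + s / 2) β₀ L p) (hA₀ : 0 ≤ A₀)
    (hs : 0 < s) (hD : 0 ≤ D) (hβ' : 0 ≤ β')
    (havI : ∀ (g : ℕ → ℝ) (K : ℕ), (∀ i, i ≤ K → 0 < g i ∧ g i ≤ γ₀) →
      ∀ m n, m ≤ n → n ≤ K → s * ((n : ℝ) - m) - D ≤ ∑ j ∈ Finset.Ico m n, βI j (prefixOf g j))
    (hup : BetaUpperH β' γ₀ βI) (hcontI : BetaContH γ₀ βI) (hcontδ : BetaContH γ₀ δ)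
    (hDγ : D * γ₁ ^ 2 ≤ β₀ * (2 + β₀)) (hDγ' : D * γ₁ ^ 2 ≤ 1 / 2) (hκ : 6 ≤ κ)
    (hsmall : Real.sqrt 2 ^ (κ - 6) * (2 * γ₁ ^ 4 / (s / 2) + γ₁ ^ 6) < 1)
    (hcs : ∀ (F : Flow) (K : ℕ) (R : ℕ → ℕ), F.SatisfiesRG K → F.InInterval (min γ₀ γ₁) K →
      (∀ j, j ≤ K → B14.IsRj L p (F.g j) (R j)) →
      CondSmallFC F (β' + s / 2) β₀ A₀ L p κ R (fun k => δ k (prefixOf F.g k)) K (s / 2)) :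
    EndpointExistence C := by
  intro m
  refine ⟨min γ₀ γ₁, lt_min hγ₀ Sm.γ_pos, fun γ hγ hγle => ?_⟩
  set gstar : ℝ := 1 / Real.sqrt (1 / γ ^ 2 + D) with hgstar
  have hgstar_pos : 0 < gstar := by positivity
  refine ⟨gstar, hgstar_pos, fun g hg hgle K => ?_⟩
  have hgs : 1 / gstar ^ 2 = 1 / γ ^ 2 + D := by
    rw [hgstar, div_pow, one_pow, Real.sq_sqrt (by positivity), one_div_one_div]
  have hgM : 1 / γ ^ 2 + D ≤ 1 / g ^ 2 := by
    rw [← hgs]; exact one_div_le_one_div_of_le (by positivity) (pow_le_pow_left₀ hg.le hgle 2)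
  obtain ⟨g0, hI, hK, -⟩ := endpointRun_of_condSmallH_avgAF hgen hsplit Sm hA₀ hs hD hβ' havI hup hcontI hcontδ hDγ
    hDγ' hκ hsmall hcs m γ hγ hγle g hg hgM K
  exact ⟨g0, hI, hK⟩

/-- **The [III] list under reading (α) at the averaged grade, along runs.**  Construction generated forward by `β = βᴵ + δ`,
halting outside, currying `β`; history-level averaged asymptotic freedom of `βᴵ` (slope `s > 0`, defect `D`) and `βᴵ ≤ β′` on
the boxes; the realised `δ` along the run conditionally small (`CondSmallFC`, threshold `s/2`).  Then with
`SmallnessFor γ (β′+s/2) β₀ L p`, `γ ≤ γ₀`, `Dγ² ≤ β₀(2+β₀)`, `Dγ² ≤ 1/2`, `(√2)^{κ−6}(2γ⁴/(s/2) + γ⁶) < 1`: ALL of (2.6)–(2.9)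
(constant `β′+s/2`) and (2.46) at the horizon of every in-interval run — pv02's bootstrap `B14DeltaBeta.flowControl_of_condSmallFC`
read through `FlowStepRuns.realised_eq_hist`. [cite: Balaban1988Convergent, (2.6)–(2.9) pp.255–256, (2.46) p.263, p.278] -/
theorem flowControl_along_of_condSmall_avgAF {C : B12.Construction} {β βI δ : HBeta}
    (hgen : ForwardGenerated C β) (hhalt : HaltsOutside C β) (hcur : CurriesHBeta C β)
    {γ₀ : ℝ} (hsplit : ∀ k, ∀ v ∈ Box γ₀ k, β k v = βI k v + δ k v)
    {γ s D β' β₀ A₀ : ℝ} {L p κ : ℕ} (Sm : B14FlowStep.SmallnessFor γ (β' + s / 2) β₀ L p) (hA₀ : 0 ≤ A₀)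
    (hγ₀ : γ ≤ γ₀) (hs : 0 < s)
    (havI : ∀ (g : ℕ → ℝ) (K : ℕ), (∀ i, i ≤ K → 0 < g i ∧ g i ≤ γ₀) →
      ∀ m n, m ≤ n → n ≤ K → s * ((n : ℝ) - m) - D ≤ ∑ j ∈ Finset.Ico m n, βI j (prefixOf g j))
    (hup : BetaUpperH β' γ₀ βI)
    (hDγ : D * γ ^ 2 ≤ β₀ * (2 + β₀)) (hDγ' : D * γ ^ 2 ≤ 1 / 2) (hκ : 6 ≤ κ)
    (hsmall : Real.sqrt 2 ^ (κ - 6) * (2 * γ ^ 4 / (s / 2) + γ ^ 6) < 1)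
    (P : B12.RunParams) (hI : (C P).flow.InInterval γ P.K)
    (R : ℕ → ℕ) (hR : ∀ j, j ≤ P.K → B14.IsRj L p ((C P).flow.g j) (R j))
    (hcs : CondSmallFC (C P).flow (β' + s / 2) β₀ A₀ L p κ R (fun k => δ k (prefixOf (C P).flow.g k)) P.K (s / 2)) :
    HorizonFacts (C P).flow (β' + s / 2) β₀ A₀ L p κ R P.K := by
  have hrg : (C P).flow.SatisfiesRG P.K := satisfiesRG_of_inInterval hgen hhalt hcur P hI
  have hsplit' : ∀ j, j < P.K → (C P).flow.β (j + 1) ((C P).flow.g j)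
      = βI j (prefixOf (C P).flow.g j) + δ j (prefixOf (C P).flow.g j) := by
    intro j hj
    obtain ⟨hpt, hbox⟩ := realised_eq_hist hcur P hγ₀ hI hj
    rw [hpt]; exact hsplit j _ hbox
  have hubI : ∀ j, j < P.K → βI j (prefixOf (C P).flow.g j) ≤ β' := fun j hj =>
    hup j _ (realised_eq_hist hcur P hγ₀ hI hj).2
  have havI' := havI (C P).flow.g P.K fun i hi => ⟨(hI i hi).1, (hI i hi).2.trans hγ₀⟩
  exact flowControl_of_condSmallFC (C P).flow P.K Sm hA₀ R hR
    (fun j => βI j (prefixOf (C P).flow.g j)) (fun k => δ k (prefixOf (C P).flow.g k))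
    hrg hI hsplit' hubI hs havI' hcs hκ hDγ hDγ' hsmall

/-- **READING (α) AT THE AVERAGED GRADE — both halves.**  Under the hypotheses of `endpointExistence_of_condSmallH_avgAF` plus
the two run-wise modelling clauses (`HaltsOutside`, `CurriesHBeta`): (i) `EndpointExistence C`, and (ii) for every
`γ ≤ min(γ₀,γ₁)` and every run of `C` staying in `]0,γ]` up to `K`, sizes `R_j` as in (2.5) exist for which ALL of (2.6)–(2.9)
(constant `β′+s/2`) and (2.46) hold at the horizon `K`.  So under reading (α) the END-statement-grade flow input at the (R10)
grade is: history-level averaged asymptotic freedom of [I]'s part (slope + defect) + the printed-type upper bound + continuity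
of `βᴵ` — and on the `δ` side the conditional (Δβ) display + continuity; nothing else. [cite: Balaban1987RG1, Thm 2 p.259] [cite: Balaban1988Convergent, (2.6)–(2.9) pp.255–256, (2.46) p.263] -/
theorem endpoint_and_flowControl_of_condSmallH_avgAF {C : B12.Construction} {β βI δ : HBeta}
    (hgen : ForwardGenerated C β) (hhalt : HaltsOutside C β) (hcur : CurriesHBeta C β) {γ₀ : ℝ} (hγ₀ : 0 < γ₀)
    (hsplit : ∀ k, ∀ v ∈ Box γ₀ k, β k v = βI k v + δ k v)
    {γ₁ s D β' β₀ A₀ : ℝ} {L p κ : ℕ} (Sm : B14FlowStep.SmallnessFor γ₁ (β' + s / 2) β₀ L p) (hA₀ : 0 ≤ A₀)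
    (hs : 0 < s) (hD : 0 ≤ D) (hβ' : 0 ≤ β')
    (havI : ∀ (g : ℕ → ℝ) (K : ℕ), (∀ i, i ≤ K → 0 < g i ∧ g i ≤ γ₀) →
      ∀ m n, m ≤ n → n ≤ K → s * ((n : ℝ) - m) - D ≤ ∑ j ∈ Finset.Ico m n, βI j (prefixOf g j))
    (hup : BetaUpperH β' γ₀ βI) (hcontI : BetaContH γ₀ βI) (hcontδ : BetaContH γ₀ δ)
    (hDγ : D * γ₁ ^ 2 ≤ β₀ * (2 + β₀)) (hDγ' : D * γ₁ ^ 2 ≤ 1 / 2) (hκ : 6 ≤ κ)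
    (hsmall : Real.sqrt 2 ^ (κ - 6) * (2 * γ₁ ^ 4 / (s / 2) + γ₁ ^ 6) < 1)
    (hcs : ∀ (F : Flow) (K : ℕ) (R : ℕ → ℕ), F.SatisfiesRG K → F.InInterval (min γ₀ γ₁) K →
      (∀ j, j ≤ K → B14.IsRj L p (F.g j) (R j)) →
      CondSmallFC F (β' + s / 2) β₀ A₀ L p κ R (fun k => δ k (prefixOf F.g k)) K (s / 2)) :
    EndpointExistence C ∧
      ∀ γ : ℝ, 0 < γ → γ ≤ min γ₀ γ₁ → ∀ P : B12.RunParams, (C P).flow.InInterval γ P.K →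
        ∃ R : ℕ → ℕ, (∀ j, B14.IsRj L p ((C P).flow.g j) (R j)) ∧
          HorizonFacts (C P).flow (β' + s / 2) β₀ A₀ L p κ R P.K := by
  refine ⟨endpointExistence_of_condSmallH_avgAF hgen hγ₀ hsplit Sm hA₀ hs hD hβ' havI hup hcontI hcontδ hDγ hDγ' hκ
    hsmall hcs, fun γ hγ hγle P hI => ?_⟩
  have hγγ₀ : γ ≤ γ₀ := hγle.trans (min_le_left _ _)
  have hγγ₁ : γ ≤ γ₁ := hγle.trans (min_le_right _ _)
  have Smγ : B14FlowStep.SmallnessFor γ (β' + s / 2) β₀ L p := smallnessFor_of_le Sm hγ hγγ₁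
  choose R hR using fun j => B14FlowStep.isRj_exists Sm.hL p ((C P).flow.g j)
  have hrg : (C P).flow.SatisfiesRG P.K := satisfiesRG_of_inInterval hgen hhalt hcur P hI
  have hI' : (C P).flow.InInterval (min γ₀ γ₁) P.K := fun k hk => ⟨(hI k hk).1, (hI k hk).2.trans hγle⟩
  exact ⟨R, hR, flowControl_along_of_condSmall_avgAF hgen hhalt hcur hsplit Smγ hA₀ hγγ₀ hs havI hup
    (defect_of_le hD hγ.le hγγ₁ hDγ) (defect_of_le hD hγ.le hγγ₁ hDγ') hκ
    (polySmall_of_le (half_pos hs) hγ.le hγγ₁ hsmall) P hI R (fun j _ => hR j)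
    (hcs (C P).flow P.K R hrg hI' (fun j _ => hR j))⟩

/-! ## 4. Instantiation at the (R10) grade: drift + one-sided constant remainder of [I]'s part, `r < b` -/

/-- **READING (α) AT THE (R10) GRADE — both halves from drift + one-sided constant remainder of [I]'s part.**  Construction
generated forward by the REALISED family `β = βᴵ + δ`, halting outside, currying `β`; [I]'s part split `βᴵ = β⁰ + β¹`
(`B12Beta.OneLoopSplit βI`) with `OneLoopDrift b A β⁰` (BINDER) and `−r ≤ β¹_{k+1}` on the `]0,γ₀]`-histories (BINDER, row an4's
printed-type slot) with `r < b` STRICTLY; `βᴵ ≤ β′` on the boxes (printed type), `βᴵ, δ` jointly continuous; `δ` conditionally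
small history-wise with threshold `(b−r)/2`; one smallness threshold `γ₁` with `2Aγ₁² ≤ β₀(2+β₀)`, `2Aγ₁² ≤ 1/2`,
`(√2)^{κ−6}(2γ₁⁴/((b−r)/2) + γ₁⁶) < 1`.  Then `EndpointExistence C` (`g⋆ = (1/γ² + 2A)^{−1/2}`) AND, along every in-interval run,
(2.6)–(2.9) (constant `β′+(b−r)/2`) ∧ (2.46).  = §3 with `s = b − r`, `D = 2A` (`histAvgAF_of_driftConst`).  So census item
C14 transfers to the (R10) grade mechanically: no β-function input beyond the primary road's own carrier with `r < b`.
[cite: Balaban1987RG1, Thm 2 p.259 and (2.12)–(2.14) p.268] [cite: Balaban1988Convergent, (2.6)–(2.9) pp.255–256, (2.46) p.263, p.271, p.278] -/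
theorem endpoint_and_flowControl_of_condSmallH_driftConst {C : B12.Construction} {β βI δ : HBeta}
    (hgen : ForwardGenerated C β) (hhalt : HaltsOutside C β) (hcur : CurriesHBeta C β) {γ₀ : ℝ} (hγ₀ : 0 < γ₀)
    (hsplit : ∀ k, ∀ v ∈ Box γ₀ k, β k v = βI k v + δ k v) (S : B12Beta.OneLoopSplit βI)
    {γ₁ b A r β' β₀ A₀ : ℝ} {L p κ : ℕ} (Sm : B14FlowStep.SmallnessFor γ₁ (β' + (b - r) / 2) β₀ L p)
    (hA₀ : 0 ≤ A₀) (hdrift : OneLoopDrift b A S.β0)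
    (hlow : ∀ k (q : Fin (k + 1) → ℝ), q ∈ B12Beta.HistBox γ₀ k → -r ≤ S.β1 k q) (hrb : r < b) (hβ' : 0 ≤ β')
    (hup : BetaUpperH β' γ₀ βI) (hcontI : BetaContH γ₀ βI) (hcontδ : BetaContH γ₀ δ)
    (hAγ : 2 * A * γ₁ ^ 2 ≤ β₀ * (2 + β₀)) (hAγ' : 2 * A * γ₁ ^ 2 ≤ 1 / 2) (hκ : 6 ≤ κ)
    (hsmall : Real.sqrt 2 ^ (κ - 6) * (2 * γ₁ ^ 4 / ((b - r) / 2) + γ₁ ^ 6) < 1)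
    (hcs : ∀ (F : Flow) (K : ℕ) (R : ℕ → ℕ), F.SatisfiesRG K → F.InInterval (min γ₀ γ₁) K →
      (∀ j, j ≤ K → B14.IsRj L p (F.g j) (R j)) →
      CondSmallFC F (β' + (b - r) / 2) β₀ A₀ L p κ R (fun k => δ k (prefixOf F.g k)) K ((b - r) / 2)) :
    EndpointExistence C ∧
      ∀ γ : ℝ, 0 < γ → γ ≤ min γ₀ γ₁ → ∀ P : B12.RunParams, (C P).flow.InInterval γ P.K →
        ∃ R : ℕ → ℕ, (∀ j, B14.IsRj L p ((C P).flow.g j) (R j)) ∧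
          HorizonFacts (C P).flow (β' + (b - r) / 2) β₀ A₀ L p κ R P.K :=
  endpoint_and_flowControl_of_condSmallH_avgAF hgen hhalt hcur hγ₀ hsplit Sm hA₀ (sub_pos.mpr hrb)
    (by linarith [hdrift.nonneg]) hβ' (histAvgAF_of_driftConst S hdrift hlow) hup hcontI hcontδ hAγ hAγ' hκ hsmall hcs

/-- The unperturbed special case `δ ≡ 0` as a check of the quantifier shape: drift + one-sided constant remainder with `r < b`,
the printed-type upper bound and continuity of `β` alone give both halves through §3–§4 (so §4 specialises to
`DriftRemainder.endpointExistence_of_drift_oneSided` — there with `r ≤ b` — plus §1's run-wise list, up to the constant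
`β′+(b−r)/2` and the halved slope). [folklore] -/
theorem endpoint_and_flowControl_driftConst_unperturbed {C : B12.Construction} {β : HBeta}
    (hgen : ForwardGenerated C β) (hhalt : HaltsOutside C β) (hcur : CurriesHBeta C β) {γ₀ : ℝ} (hγ₀ : 0 < γ₀)
    (S : B12Beta.OneLoopSplit β) {γ₁ b A r β' β₀ A₀ : ℝ} {L p κ : ℕ}
    (Sm : B14FlowStep.SmallnessFor γ₁ (β' + (b - r) / 2) β₀ L p) (hA₀ : 0 ≤ A₀) (hdrift : OneLoopDrift b A S.β0)
    (hlow : ∀ k (q : Fin (k + 1) → ℝ), q ∈ B12Beta.HistBox γ₀ k → -r ≤ S.β1 k q) (hrb : r < b) (hβ' : 0 ≤ β')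
    (hup : BetaUpperH β' γ₀ β) (hcont : BetaContH γ₀ β)
    (hAγ : 2 * A * γ₁ ^ 2 ≤ β₀ * (2 + β₀)) (hAγ' : 2 * A * γ₁ ^ 2 ≤ 1 / 2) (hκ : 6 ≤ κ)
    (hsmall : Real.sqrt 2 ^ (κ - 6) * (2 * γ₁ ^ 4 / ((b - r) / 2) + γ₁ ^ 6) < 1) :
    EndpointExistence C ∧
      ∀ γ : ℝ, 0 < γ → γ ≤ min γ₀ γ₁ → ∀ P : B12.RunParams, (C P).flow.InInterval γ P.K →
        ∃ R : ℕ → ℕ, (∀ j, B14.IsRj L p ((C P).flow.g j) (R j)) ∧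
          HorizonFacts (C P).flow (β' + (b - r) / 2) β₀ A₀ L p κ R P.K :=
  endpoint_and_flowControl_of_condSmallH_driftConst (βI := β) (δ := fun _ _ => 0) hgen hhalt hcur hγ₀
    (fun k v _ => by simp) S Sm hA₀ hdrift hlow hrb hβ' hup hcont (fun _ => continuousOn_const) hAγ hAγ' hκ hsmall
    (condSmallH_of_zero (by linarith : (0 : ℝ) ≤ (b - r) / 2))


/-! ## 5. (v1.1) The remainder slot filled by the PRINTED CHAIN (row an4's `RemainderChain.Chain`), strict ε₁-restriction -/

/-- **THE [III] LIST FROM THE DRIFT FORM AND THE PRINTED REMAINDER CHAIN, `ε₁·K_rem < b`.**  A `RemainderChain.Chain` with the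
printed signs gives `|β¹_{k+1}| ≤ ε₁·K_rem` for all k on the `]0,γ₀]`-histories (`RemainderChain.Chain.abs_beta1_le`, row an4; the
leaves inside the chain stay located); with `OneLoopDrift b A β⁰` (BINDER) and the STRICT restriction `ε₁·K_rem < b` (in place of
`DriftRemainder.betaPartialSumsLowerH_of_drift_chain`'s `≤ b`), the printed upper bound, `SmallnessFor γ β′ β₀ L p` (`γ ≤ γ₀`) and the
γ-smallness of §1 (slope `b − ε₁·K_rem`, defect `2A`): sizes `R_j` of (2.5) and ALL of (2.6)–(2.9) printed constants ∧ (2.46) at the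
horizon of every in-interval run.  = `flowControl_along_of_driftRemainderConst` with `r := ε₁·K_rem`.
[cite: Balaban1988Convergent, (2.5)–(2.9) pp.255–256 and (2.46) p.263] [cite: Balaban1988RG2Cluster, (2.41) p.21] -/
theorem flowControl_along_of_driftChain {C : B12.Construction} {β : HBeta} (hgen : ForwardGenerated C β)
    (hhalt : HaltsOutside C β) (hcur : CurriesHBeta C β) {S : B12Beta.OneLoopSplit β}
    {d : ℕ} {μ ν : Fin d} {c : B13.Consts} {α₂ B₃ c₁ K₀ K₁ : ℝ} {γ γ₀ b A β' β₀ : ℝ} {L p : ℕ}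
    (Rc : RemainderChain.Chain d μ ν S γ₀ c α₂ B₃ c₁ K₀ K₁) (hs : RemainderChain.ChainSigns c α₂ B₃ K₀)
    (Sm : B14FlowStep.SmallnessFor γ β' β₀ L p) {A₀ : ℝ} (hA₀ : 0 ≤ A₀) (hγ₀ : γ ≤ γ₀)
    (hdrift : OneLoopDrift b A S.β0) (hε₁ : c.ε₁ * RemainderChain.remCoeff d c α₂ B₃ c₁ K₀ K₁ < b)
    (hup : BetaUpperH β' γ₀ β)
    (hAγ : 2 * A * γ ^ 2 ≤ β₀ * (2 + β₀)) (hAγ' : 2 * A * γ ^ 2 ≤ 1 / 2) {κ₀ : ℕ} (hκ : 6 ≤ κ₀)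
    (hsmall : Real.sqrt 2 ^ (κ₀ - 6) *
      (2 * γ ^ 4 / (b - c.ε₁ * RemainderChain.remCoeff d c α₂ B₃ c₁ K₀ K₁) + γ ^ 6) < 1)
    (P : B12.RunParams) (hI : (C P).flow.InInterval γ P.K) :
    ∃ Rj : ℕ → ℕ, (∀ j, B14.IsRj L p ((C P).flow.g j) (Rj j)) ∧ HorizonFacts (C P).flow β' β₀ A₀ L p κ₀ Rj P.K :=
  flowControl_along_of_driftRemainderConst hgen hhalt hcur S Sm hA₀ hγ₀ hdrift (Rc.abs_beta1_le hs) hε₁ hup hAγ hAγ' hκ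
    hsmall P hI

/-- **The same with the restriction in the convenient form `2·ε₁·K_rem ≤ b`**: then `−b/2 ≤ β¹_{k+1}` on the histories, and §1
applies with `r := b/2` — slope `b/2`, defect `2A`, γ-smallness `(√2)^{κ₀−6}(2γ⁴/(b/2) + γ⁶) < 1` (the same polynomial smallness as
`FlowConsumers.drift_flowControl_along`, whose (AF-1) slot this replaces). [cite: Balaban1988Convergent, (2.5)–(2.9) pp.255–256 and (2.46) p.263] [cite: Balaban1988RG2Cluster, (2.41) p.21] -/
theorem flowControl_along_of_driftChain_half {C : B12.Construction} {β : HBeta} (hgen : ForwardGenerated C β)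
    (hhalt : HaltsOutside C β) (hcur : CurriesHBeta C β) {S : B12Beta.OneLoopSplit β}
    {d : ℕ} {μ ν : Fin d} {c : B13.Consts} {α₂ B₃ c₁ K₀ K₁ : ℝ} {γ γ₀ b A β' β₀ : ℝ} {L p : ℕ}
    (Rc : RemainderChain.Chain d μ ν S γ₀ c α₂ B₃ c₁ K₀ K₁) (hs : RemainderChain.ChainSigns c α₂ B₃ K₀)
    (Sm : B14FlowStep.SmallnessFor γ β' β₀ L p) {A₀ : ℝ} (hA₀ : 0 ≤ A₀) (hγ₀ : γ ≤ γ₀) (hb : 0 < b)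
    (hdrift : OneLoopDrift b A S.β0) (hε₁ : 2 * (c.ε₁ * RemainderChain.remCoeff d c α₂ B₃ c₁ K₀ K₁) ≤ b)
    (hup : BetaUpperH β' γ₀ β)
    (hAγ : 2 * A * γ ^ 2 ≤ β₀ * (2 + β₀)) (hAγ' : 2 * A * γ ^ 2 ≤ 1 / 2) {κ₀ : ℕ} (hκ : 6 ≤ κ₀)
    (hsmall : Real.sqrt 2 ^ (κ₀ - 6) * (2 * γ ^ 4 / (b / 2) + γ ^ 6) < 1)
    (P : B12.RunParams) (hI : (C P).flow.InInterval γ P.K) :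
    ∃ Rj : ℕ → ℕ, (∀ j, B14.IsRj L p ((C P).flow.g j) (Rj j)) ∧ HorizonFacts (C P).flow β' β₀ A₀ L p κ₀ Rj P.K := by
  have hrem := Rc.abs_beta1_le hs
  have hlow : ∀ k (q : Fin (k + 1) → ℝ), q ∈ B12Beta.HistBox γ₀ k → -(b / 2) ≤ S.β1 k q := fun k q hq => by
    have h1 := (abs_le.mp (hrem k q hq)).1
    linarith
  have e : b - b / 2 = b / 2 := by ring
  have hsmall' : Real.sqrt 2 ^ (κ₀ - 6) * (2 * γ ^ 4 / (b - b / 2) + γ ^ 6) < 1 := by rw [e]; exact hsmall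
  exact flowControl_along_of_driftConst' hgen hhalt hcur S Sm hA₀ hγ₀ hdrift hlow (by linarith) hup hAγ hAγ' hκ hsmall' P hI

/-- **The cell's END statement WITH (2.46) from the drift form and the PRINTED remainder chain** (`2·ε₁·K_rem ≤ b`):
`DriftRemainder.endpointExistence_of_drift_chain`'s content through `FlowStepRuns.p355Unconditional_of_partialSums` (hnodes kept —
Gloss 1) AND (2.46) along every in-interval run (slope `b/2`, defect `2A`).  The leaves inside the chain stay located; the drift is a
BINDER. [cite: Balaban1989LargeFieldII, p.355; Balaban1988Convergent, (2.46) p.263; Balaban1988RG2Cluster, (2.41) p.21] -/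
theorem driftChain_p355_and_sum246 (w : World) (hγw : 0 < w.γ) {γ₀ : ℝ} (hγ₀ : w.γ ≤ γ₀) (hβup : 0 ≤ w.βup)
    (hnodes : ∀ P, Nodes (leaves w P)) {β : HBeta} (hgen : ForwardGenerated w.C.toB12 β)
    (hhalt : HaltsOutside w.C.toB12 β) (hcur : CurriesHBeta w.C.toB12 β) (hcont : BetaContH γ₀ β)
    (hup : BetaUpperH w.βup γ₀ β) {S : B12Beta.OneLoopSplit β}
    {d : ℕ} {μ ν : Fin d} {c : B13.Consts} {α₂ B₃ c₁ K₀ K₁ b A : ℝ}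
    (Rc : RemainderChain.Chain d μ ν S γ₀ c α₂ B₃ c₁ K₀ K₁) (hs : RemainderChain.ChainSigns c α₂ B₃ K₀) (hb : 0 < b)
    (hdrift : OneLoopDrift b A S.β0) (hε₁ : 2 * (c.ε₁ * RemainderChain.remCoeff d c α₂ B₃ c₁ K₀ K₁) ≤ b)
    (hAγ : 2 * A * w.γ ^ 2 ≤ w.β₀ * (2 + w.β₀)) (hAγ' : 2 * A * w.γ ^ 2 ≤ 1 / 2) {κ₀ : ℕ} (hκ : 6 ≤ κ₀)
    (hsmall : Real.sqrt 2 ^ (κ₀ - 6) * (2 * w.γ ^ 4 / (b / 2) + w.γ ^ 6) < 1) :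
    (B16.Sect2Unconditional w.C ∧
      ∃ Em Ep : ℝ, ∀ m : ℕ, ∃ gstar : ℝ, 0 < gstar ∧ ∀ g : ℝ, 0 < g → g ≤ gstar →
        ∀ K : ℕ, ∃ g0 : ℝ, (w.C ⟨K, m, g0⟩).flow.g K = g ∧
          ∀ k, k ≤ K → ∀ V : (w.C ⟨K, m, g0⟩).Cfg k, B16.UVIneq (w.C ⟨K, m, g0⟩) k V Em Ep) ∧
    ∀ P : B12.RunParams, (w.C.toB12 P).flow.InInterval w.γ P.K →
      B14FlowStep.SumIneq246 (w.C.toB12 P).flow.g κ₀ P.K := by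
  have hrem := Rc.abs_beta1_le hs
  have hlow : ∀ k (q : Fin (k + 1) → ℝ), q ∈ B12Beta.HistBox γ₀ k → -(b / 2) ≤ S.β1 k q := fun k q hq => by
    have h1 := (abs_le.mp (hrem k q hq)).1
    linarith
  have e : b - b / 2 = b / 2 := by ring
  have hsmall' : Real.sqrt 2 ^ (κ₀ - 6) * (2 * w.γ ^ 4 / (b - b / 2) + w.γ ^ 6) < 1 := by rw [e]; exact hsmall
  refine ⟨p355Unconditional_of_partialSums w hγw hγ₀ (by linarith [hdrift.nonneg]) hβup hAγ hnodes hgen hhalt hcur hcont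
    (betaPartialSumsLowerH_of_drift_oneSided S hdrift hlow (by linarith)) hup, fun P hI => ?_⟩
  exact sum246_along_of_driftConst hgen hhalt hcur S hγ₀ hdrift hlow (by linarith) hAγ' hκ hsmall' P hI

end

end Literature.MathematicalPhysics.QuantumFieldTheory.Balaban1983to89.Beta.ConstRemainderConsumers
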